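import Literature.NumberTheory.Transcendental.RoySmallValuePhiNonvanishing
import Mathlib.RingTheory.MvPolynomial.WeightedHomogeneous
import HarnessLib

/-!
# Roy's small value estimate for `𝔾ₐ × 𝔾ₘ` — `Φ` as an integer polynomial in the coefficients

Topic `Literature/NumberTheory/Transcendental`. Part of the formalisation of the proof of Roy 2013,
Theorem 1.1 (named fact `roy2013_thm_1_1`, `RoySmallValueEstimates.lean`). Source: D. Roy,
*A small value estimate for `𝔾ₐ × 𝔾ₘ`*, Mathematika 59 (2013) 333–363 = arXiv:1301.0663, §2
(p. 6) and §5 (proof of Theorem 5.2, p. 14):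

> [...] whose underlying polynomial relative to the basis of `(t+1)`-tuples of monomials [...] has
> coefficients in `ℤ` [...]. Moreover, `F` is separately homogeneous of degree `D^t deg(Z)` in each
> of its `t + 1` polynomial arguments.
> [...] the polynomial map `Φ : ℂ[X]_D³ → ℂ` given by `Φ(Q) = det(φ_Q)` [...]

In this development the resultant `Res_D` is replaced by the determinant `Φ = royPhi` of the proof
of Theorem 5.2. This file provides its "underlying polynomial": an honest `MvPolynomial` over `ℤ`
in the variables `c_{i,ν}` = coefficient of `X^ν` (`|ν| = D`) in `Qᵢ` (`royPhiPoly`), whose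
evaluation at the coefficients of `(Q₀, Q₁, Q₂)` is `Φ(Q)` (`aeval_royPhiPoly`), which is
homogeneous of degree `#M₂` in the block of variables of `Q₂` (`isWeightedHomogeneous_royPhiPoly`),
and its specialisation `F(R) = Φ(P, Q, R)` as a form of degree `#M₂` (`= D²`) in the coefficients of
`R`, over any coefficient ring (`royF`, `eval_royF`, `isHomogeneous_royF`, `map_royF`) — the
object through which the arithmetic of §§6–7 (integrality of values, Gauss's lemma) is run.

## References

* [Roy2013] D. Roy, *A small value estimate for 𝔾ₐ × 𝔾ₘ*, Mathematika 59 (2013), 333–363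
  (arXiv:1301.0663), §2 and §5 (proof of Theorem 5.2).
-/

noncomputable section

open MvPolynomial Finset Module Matrix

namespace Literature.NumberTheory.Transcendental

namespace Roy2013

variable {D : ℕ} {M₁ M₂ : Finset (Fin 3 →₀ ℕ)}

/-! ### Indices -/

/-- Rows of `M_Q`: exponents of degree `3D`. [cite: Roy2013, §5, proof of Theorem 5.2] -/
abbrev PhiRow (D : ℕ) : Type := ↥(finsuppAntidiag (univ : Finset (Fin 3)) (3 * D))

/-- Columns of `M_Q`: exponents of degree `2D`, and the two monomial sets `M₁, M₂`.
[cite: Roy2013, §5, proof of Theorem 5.2] -/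
abbrev PhiCol (D : ℕ) (M₁ M₂ : Finset (Fin 3 →₀ ℕ)) : Type :=
  ↥(finsuppAntidiag (univ : Finset (Fin 3)) (2 * D)) ⊕ (↥M₁ ⊕ ↥M₂)

/-- The variables `c_{i,ν}`: coefficient of `X^ν` (`|ν| = D`) in `Qᵢ`. [cite: Roy2013, §2] -/
abbrev PhiVar (D : ℕ) : Type := Fin 3 × ↥(finsuppAntidiag (univ : Finset (Fin 3)) D)

/-- `e − μ` has degree `D` for `|e| = 3D`, `|μ| = 2D`, `μ ≤ e`. [folklore] -/
theorem sub_mem_finsuppAntidiag {e μ : Fin 3 →₀ ℕ}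
    (he : e ∈ finsuppAntidiag (univ : Finset (Fin 3)) (3 * D)) (hμ : μ.degree = 2 * D)
    (h : μ ≤ e) : e - μ ∈ finsuppAntidiag (univ : Finset (Fin 3)) D := by
  rw [mem_finsuppAntidiag] at he ⊢
  refine ⟨?_, Finset.subset_univ _⟩
  have h1 : (e - μ).degree + μ.degree = e.degree := by
    rw [← map_add, tsub_add_cancel_of_le h]
  have h2 : e.degree = 3 * D := by rw [Finsupp.degree_eq_sum]; exact he.1
  rw [hμ, h2] at h1
  have h3 : (e - μ).degree = D := by omega
  rwa [Finsupp.degree_eq_sum] at h3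

/-! ### The generic matrix and `Φ` as a polynomial -/

/-- Generic entry of `M_Q`: the variable `c_{i, e−μ}` in row `e`, column `(i, μ)` (and `0` if
`μ ≰ e`). [cite: Roy2013, §5, proof of Theorem 5.2] -/
def genEntry (D : ℕ) (M₁ M₂ : Finset (Fin 3 →₀ ℕ)) (e : PhiRow D) (c : PhiCol D M₁ M₂) :
    MvPolynomial (PhiVar D) ℤ :=
  if h : colExp c ≤ e.1 ∧ e.1 - colExp c ∈ finsuppAntidiag (univ : Finset (Fin 3)) D then
    X (colBlock c, ⟨e.1 - colExp c, h.2⟩)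
  else 0

/-- **`Φ` as an integer polynomial in the coefficients** (`det` of the generic matrix, columns
identified with rows through `σ`). [cite: Roy2013, §2 and §5, proof of Theorem 5.2] -/
def royPhiPoly (D : ℕ) (M₁ M₂ : Finset (Fin 3 →₀ ℕ)) (σ : PhiCol D M₁ M₂ ≃ PhiRow D) :
    MvPolynomial (PhiVar D) ℤ :=
  ((Matrix.of (genEntry D M₁ M₂)).reindex (Equiv.refl _) σ).det

/-- The coefficient vector of a triple `Q`. [cite: Roy2013, §2] -/
def coeffVec {K : Type*} [CommSemiring K] (Qs : Fin 3 → MvPolynomial (Fin 3) K) :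
    PhiVar D → K :=
  fun v => coeff v.2.1 (Qs v.1)

/-- Entries: the generic entry evaluates to the entry of `M_Q`.
[cite: Roy2013, §5, proof of Theorem 5.2] -/
theorem aeval_genEntry (hM₁ : ∀ μ ∈ M₁, μ.degree = 2 * D) (hM₂ : ∀ μ ∈ M₂, μ.degree = 2 * D)
    (Qs : Fin 3 → CX) (e : PhiRow D) (c : PhiCol D M₁ M₂) :
    aeval (coeffVec Qs) (genEntry D M₁ M₂ e c) = royMatrix D M₁ M₂ Qs e c := by
  classical
  rw [royMatrix_apply, coeff_monomial_mul', genEntry]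
  by_cases h : colExp c ≤ e.1
  · have hmem := sub_mem_finsuppAntidiag e.2 (degree_colExp hM₁ hM₂ c) h
    rw [dif_pos ⟨h, hmem⟩, if_pos h, aeval_X, one_mul]; rfl
  · rw [dif_neg (fun h' => h h'.1), if_neg h, map_zero]

/-- **`Φ(Q)` is the value of `royPhiPoly` at the coefficients of `Q`.**
[cite: Roy2013, §2 and §5, proof of Theorem 5.2] -/
theorem aeval_royPhiPoly (hM₁ : ∀ μ ∈ M₁, μ.degree = 2 * D) (hM₂ : ∀ μ ∈ M₂, μ.degree = 2 * D)
    (σ : PhiCol D M₁ M₂ ≃ PhiRow D) (Qs : Fin 3 → CX) :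
    aeval (coeffVec Qs) (royPhiPoly D M₁ M₂ σ) = royPhi D M₁ M₂ σ Qs := by
  rw [royPhiPoly, royPhi, AlgHom.map_det]
  congr 1
  ext r r'
  simp only [AlgHom.mapMatrix_apply, Matrix.map_apply, Matrix.reindex_apply,
    Matrix.submatrix_apply, Equiv.refl_symm, Equiv.refl_apply, Matrix.of_apply,
    aeval_genEntry hM₁ hM₂]

/-! ### Homogeneity in the third block -/

/-- Weight `1` on the coefficients of `Q₂`, `0` on those of `Q₀, Q₁`. [cite: Roy2013, §2] -/
def blockWeight (D : ℕ) : PhiVar D → ℕ := fun v => if v.1 = 2 then 1 else 0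

/-- Generic entries are weighted-homogeneous. [cite: Roy2013, §5, proof of Theorem 5.2] -/
theorem isWeightedHomogeneous_genEntry (e : PhiRow D) (c : PhiCol D M₁ M₂) :
    IsWeightedHomogeneous (blockWeight D) (genEntry D M₁ M₂ e c)
      (if colBlock c = 2 then 1 else 0) := by
  rw [genEntry]
  split_ifs with h h2 h2
  · have hw := isWeightedHomogeneous_X (R := ℤ) (blockWeight D) (colBlock c, ⟨e.1 - colExp c, h.2⟩)
    rwa [blockWeight, if_pos h2] at hw
  · have hw := isWeightedHomogeneous_X (R := ℤ) (blockWeight D) (colBlock c, ⟨e.1 - colExp c, h.2⟩)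
    rwa [blockWeight, if_neg h2] at hw
  · exact isWeightedHomogeneous_zero _ _ _
  · exact isWeightedHomogeneous_zero _ _ _

/-- The number of columns of the third block is `#M₂`. [cite: Roy2013, §5, Lemma 5.1] -/
theorem sum_ite_colBlock_eq_two :
    ∑ c : PhiCol D M₁ M₂, (if colBlock c = 2 then 1 else 0) = M₂.card := by
  rw [Fintype.sum_sum_type, Fintype.sum_sum_type]
  simp [colBlock]

/-- **`Φ` is homogeneous of degree `#M₂` in `Q₂`** (one column of `M_Q` per element of `M₂`
involves `Q₂`, linearly). [cite: Roy2013, §2 ("separately homogeneous") and §5] -/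
theorem isWeightedHomogeneous_royPhiPoly (σ : PhiCol D M₁ M₂ ≃ PhiRow D) :
    IsWeightedHomogeneous (blockWeight D) (royPhiPoly D M₁ M₂ σ) M₂.card := by
  classical
  rw [royPhiPoly, Matrix.det_apply']
  refine IsWeightedHomogeneous.sum _ _ _ fun τ _ => ?_
  have hprod : IsWeightedHomogeneous (blockWeight D)
      (∏ r, ((Matrix.of (genEntry D M₁ M₂)).reindex (Equiv.refl _) σ) (τ r) r) M₂.card := by
    have h := IsWeightedHomogeneous.prod (univ : Finset (PhiRow D))
      (fun r => ((Matrix.of (genEntry D M₁ M₂)).reindex (Equiv.refl _) σ) (τ r) r)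
      (fun r => if colBlock (σ.symm r) = 2 then 1 else 0) (w := blockWeight D)
      (fun r _ => by
        simp only [Matrix.reindex_apply, Matrix.submatrix_apply, Equiv.refl_symm,
          Equiv.refl_apply, Matrix.of_apply]
        exact isWeightedHomogeneous_genEntry _ _)
    rwa [show (∑ r : PhiRow D, if colBlock (σ.symm r) = 2 then 1 else 0) = M₂.card by
      rw [← sum_ite_colBlock_eq_two (D := D) (M₁ := M₁) (M₂ := M₂)]
      exact Equiv.sum_comp σ.symm (fun c => if colBlock c = 2 then 1 else 0)] at h
  rcases Int.units_eq_one_or (Equiv.Perm.sign τ) with h | h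
  · rw [h]; simpa using hprod
  · rw [h]
    simp only [Units.val_neg, Units.val_one, Int.cast_neg, Int.cast_one, neg_one_mul]
    exact (mem_weightedHomogeneousSubmodule _ _ _ _).mp
      (Submodule.neg_mem _ ((mem_weightedHomogeneousSubmodule _ _ _ _).mpr hprod))

/-! ### The specialisation `F(R) = Φ(P, Q, R)` -/

/-- Substituting the coefficients of `P, Q` for the first two blocks and keeping the third block as
variables. [cite: Roy2013, §6, proof of Proposition 6.4 (the map `F(R) = Res_D(P, Q, R)`)] -/
def phiSpec {K : Type*} [CommRing K] (P Q : MvPolynomial (Fin 3) K) :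
    PhiVar D → MvPolynomial ↥(finsuppAntidiag (univ : Finset (Fin 3)) D) K :=
  fun v => ![C (coeff v.2.1 P), C (coeff v.2.1 Q), X v.2] v.1

/-- **`F = Φ(P, Q, ·)` as a polynomial in the coefficients of the last argument**, over any
coefficient ring. [cite: Roy2013, §6, proof of Proposition 6.4] -/
def royF (D : ℕ) (M₁ M₂ : Finset (Fin 3 →₀ ℕ)) (σ : PhiCol D M₁ M₂ ≃ PhiRow D)
    {K : Type*} [CommRing K] (P Q : MvPolynomial (Fin 3) K) :
    MvPolynomial ↥(finsuppAntidiag (univ : Finset (Fin 3)) D) K :=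
  aeval (phiSpec P Q) (royPhiPoly D M₁ M₂ σ)

/-- Evaluating a substitution: `eval g (aeval f p) = aeval (eval g ∘ f) p` for integer `p`.
[folklore] -/
theorem eval_aeval_int {V W K : Type*} [CommRing K] (f : V → MvPolynomial W K) (g : W → K)
    (p : MvPolynomial V ℤ) : eval g (aeval f p) = aeval (fun v => eval g (f v)) p := by
  induction p using MvPolynomial.induction_on with
  | C r => simp
  | add p q hp hq => rw [map_add, map_add, hp, hq, map_add]
  | mul_X p v hp => rw [map_mul, map_mul, hp, map_mul, aeval_X, aeval_X]

/-- Base-changing a substitution: `map φ (aeval f p) = aeval (map φ ∘ f) p` for integer `p`.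
[folklore] -/
theorem map_aeval_int {V W K K' : Type*} [CommRing K] [CommRing K'] (φ : K →+* K')
    (f : V → MvPolynomial W K) (p : MvPolynomial V ℤ) :
    map φ (aeval f p) = aeval (fun v => map φ (f v)) p := by
  induction p using MvPolynomial.induction_on with
  | C r => simp
  | add p q hp hq => rw [map_add, map_add, hp, hq, map_add]
  | mul_X p v hp => rw [map_mul, map_mul, hp, map_mul, aeval_X, aeval_X]

/-- **`F(R) = Φ(P, Q, R)`.** [cite: Roy2013, §6, proof of Proposition 6.4] -/
theorem eval_royF (hM₁ : ∀ μ ∈ M₁, μ.degree = 2 * D) (hM₂ : ∀ μ ∈ M₂, μ.degree = 2 * D)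
    (σ : PhiCol D M₁ M₂ ≃ PhiRow D) (P Q R : CX) :
    eval (fun ν => coeff ν.1 R) (royF D M₁ M₂ σ P Q) = royPhi D M₁ M₂ σ ![P, Q, R] := by
  have hfg : (fun v : PhiVar D => eval (fun ν : ↥(finsuppAntidiag (univ : Finset (Fin 3)) D) =>
      coeff ν.1 R) (phiSpec P Q v)) = coeffVec ![P, Q, R] := by
    funext v
    obtain ⟨i, ν⟩ := v
    simp only [phiSpec, coeffVec]
    fin_cases i <;> simp
  rw [← aeval_royPhiPoly hM₁ hM₂ σ, royF, eval_aeval_int, hfg]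

/-- Substituting forms of degree `w(v)` for the variables of a weighted-homogeneous polynomial of
weight `n` gives a form of degree `n`. [folklore] -/
theorem isHomogeneous_aeval_of_isWeightedHomogeneous {σ τ K : Type*} [CommRing K]
    {w : σ → ℕ}
    {φ : MvPolynomial σ ℤ} {n : ℕ} (hφ : IsWeightedHomogeneous w φ n)
    {g : σ → MvPolynomial τ K} (hg : ∀ v, (g v).IsHomogeneous (w v)) :
    (aeval g φ).IsHomogeneous n := by
  classical
  rw [φ.as_sum, map_sum]
  refine IsHomogeneous.sum _ _ _ fun d hd => ?_
  rw [aeval_monomial, eq_intCast, ← map_intCast (C : K →+* MvPolynomial τ K)]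
  have hw : Finsupp.weight w d = n := hφ (mem_support_iff.mp hd)
  have hp : (d.prod fun i k => g i ^ k).IsHomogeneous n := by
    rw [Finsupp.prod, ← hw, Finsupp.weight_apply, Finsupp.sum]
    refine IsHomogeneous.prod _ _ _ fun v _ => ?_
    rw [smul_eq_mul]
    have h := (hg v).pow (d v)
    rwa [mul_comm] at h
  have h := (isHomogeneous_C τ ((coeff d φ : ℤ) : K)).mul hp
  rwa [zero_add] at h

/-- **`F` is a form of degree `#M₂`** in the coefficients of `R`.
[cite: Roy2013, §6, proof of Proposition 6.4 ("`deg(F) = D²`")] -/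
theorem isHomogeneous_royF (σ : PhiCol D M₁ M₂ ≃ PhiRow D) {K : Type*} [CommRing K]
    (P Q : MvPolynomial (Fin 3) K) : (royF D M₁ M₂ σ P Q).IsHomogeneous M₂.card := by
  refine isHomogeneous_aeval_of_isWeightedHomogeneous (isWeightedHomogeneous_royPhiPoly σ)
    fun v => ?_
  obtain ⟨i, ν⟩ := v
  fin_cases i
  · simpa [phiSpec, blockWeight] using isHomogeneous_C _ (coeff ν.1 P)
  · simpa [phiSpec, blockWeight] using isHomogeneous_C _ (coeff ν.1 Q)
  · simpa [phiSpec, blockWeight] using isHomogeneous_X K ν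

/-- **`F` is defined over the coefficient ring of `P, Q`**: base change commutes with `royF`.
In particular, for `P, Q` with integer coefficients `F` has integer coefficients.
[cite: Roy2013, §2 ("coefficients in `ℤ`")] -/
theorem map_royF (σ : PhiCol D M₁ M₂ ≃ PhiRow D) {K K' : Type*} [CommRing K] [CommRing K']
    (f : K →+* K') (P Q : MvPolynomial (Fin 3) K) :
    map f (royF D M₁ M₂ σ P Q) = royF D M₁ M₂ σ (map f P) (map f Q) := by
  have hfg : (fun v : PhiVar D => map f (phiSpec P Q v)) =
      phiSpec (D := D) (map f P) (map f Q) := by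
    funext v
    obtain ⟨i, ν⟩ := v
    simp only [phiSpec]
    fin_cases i <;> simp [map_C, map_X, coeff_map]
  rw [royF, royF, map_aeval_int, hfg]

/-- `F ≢ 0` as soon as `Φ(P, Q, R₀) ≠ 0` for one `R₀`. [cite: Roy2013, §6, proof of Prop. 6.4] -/
theorem royF_ne_zero (hM₁ : ∀ μ ∈ M₁, μ.degree = 2 * D) (hM₂ : ∀ μ ∈ M₂, μ.degree = 2 * D)
    (σ : PhiCol D M₁ M₂ ≃ PhiRow D) {P Q R₀ : CX} (h : royPhi D M₁ M₂ σ ![P, Q, R₀] ≠ 0) :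
    royF D M₁ M₂ σ P Q ≠ 0 := fun h0 => h (by rw [← eval_royF hM₁ hM₂ σ P Q R₀, h0, map_zero])

/-- `F(R) = 0` whenever `R` has a common projective zero with `P` and `Q` (and all three are forms
of degree `D`). [cite: Roy2013, §2 ("whose zeros are the tuples having a common zero on `Z`")] -/
theorem eval_royF_eq_zero_of_common_zero (hM₁ : ∀ μ ∈ M₁, μ.degree = 2 * D)
    (hM₂ : ∀ μ ∈ M₂, μ.degree = 2 * D) (σ : PhiCol D M₁ M₂ ≃ PhiRow D) {P Q R : CX}
    (hP : P.IsHomogeneous D) (hQ : Q.IsHomogeneous D) (hR : R.IsHomogeneous D) {α : Fin 3 → ℂ}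
    (hα : α ≠ 0) (hPα : MvPolynomial.aeval α P = 0) (hQα : MvPolynomial.aeval α Q = 0)
    (hRα : MvPolynomial.aeval α R = 0) :
    eval (fun ν => coeff ν.1 R) (royF D M₁ M₂ σ P Q) = 0 := by
  rw [eval_royF hM₁ hM₂]
  exact royPhi_eq_zero_of_common_zero hM₁ hM₂ σ
    (Fin.forall_fin_succ.mpr ⟨hP, Fin.forall_fin_two.mpr ⟨hQ, hR⟩⟩) hα
    (Fin.forall_fin_succ.mpr ⟨hPα, Fin.forall_fin_two.mpr ⟨hQα, hRα⟩⟩)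

end Roy2013

end Literature.NumberTheory.Transcendental
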